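import Summits.Ventures.Crystal3D.Kissing125.Geometry2
import Literature.Geometry.DiscreteGeometry.KissingSearchGeometry
import HarnessLib

/-!
# The class `𝒱(5/2)`, its `KConf` at `κ = 7/32`, and rigidity at `σ = 7/8` — K25 copy at `κ = 7/32` (`h = 5/4`), part 3/4

HONEST FRAMING (cell pub-crystal3d, K-path at `h = 5/4`): this is NOT a result printed by Hales.  It is his
METHOD (arXiv:1209.6043, Theorem 3: the main estimate + the classification of the contact graphs of kissing
configurations, in the tree's form of a verified interval-arithmetic growth search, `Literature/…/KissingSearch*.lean`)
RE-RUN at the separation `5/2` instead of `2h₀ = 2.52` (largest long-side cosine `κ = 1 − (5/4)²/2 = 7/32` instead of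
`κ₀ = 1031/5000`).  The declarations are namespace-shadowing COPIES of the tree's declarations (same names, inside
`namespace Summit.Ventures.Crystal3D.Kissing125[.KissingSearch]`, original docstrings and citation tags kept — the tags
name the printed METHOD step each declaration implements); the diff to the originals is stated per file.  Generated by
`HOME/lean/kissing125/gen/mkfiles.py`; audit recipe in `HOME/lean/kissing125/README.md`.  Nothing here is asserted
about GAP(1.26) or any census.

THIS FILE: (a) the predicate `IsKissingConfig25` (= `IsGapKissingConfig (5/2)` of `Bulk/GapReduction.lean`, same shape) with its `V/2` bookkeeping (copies of `FejesTothKissingTwelve` / `KissingFacetPenalty` Part C lemmas, separation `⟪·,·⟫ = 1/2 ∨ ≤ 7/32`); (b) `≤ 4` contacts at a point: copy of `KissingNodeDegree` Part D with `2h₀ ↦ 5/2` (numeric input `1 − (5/2)²/6 = −1/24 < 17/81`) and of `KissingUnitContactDegree`; (c) the geometric dictionary: copy of `KissingSearchGeometry.lean` (`IsKissingConfig ↦ IsKissingConfig25`, the structure `KConf` being the 7/32 one of `SearchDefs`), ending in `contactGraphFccOrHcp25_of_forall_concl`; (d) Lemma 10 at `σ = 4 − 2(5/4)² = 7/8 <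 8/9`: copy of `isArrangedIn_of_contactGraph_iso` (+ FCC/HCP corollaries) on the tree's generic `IsRealization` rigidity, and `isArrangedIn_of_forall_concl25`.  (Part 3 of 4: lines 514–821 of the transformed copy; the split is only for the 400-line rule.)
  v3.1 (gate `dedup.landed`): uses of `triAngleAt_le_pi'` call the tree's `Literature.Geometry.DiscreteGeometry.triAngleAt_le_pi'` by full name (hence `import …KissingSearchGeometry`).
  v3.3 (same lint): the use of `Pfun_pos_of_three_tight` calls the tree's `Literature.Geometry.DiscreteGeometry.KissingSearch.Pfun_pos_of_three_tight` by full name (the K25 `Pfun` unfolds to the tree's).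

## References
* T. C. Hales, *A proof of Fejes Tóth's conjecture on sphere packings with kissing number twelve*,
  arXiv:1209.6043 (2012): Definition 1, Theorem 2 (main estimate `d₃`), Theorem 3, Lemmas 7–10. [`Hales2012`]
* R. E. Moore, *Interval Analysis* (1966), Theorem 3.1, §4.4. [`Moore1966`]
-/

noncomputable section

namespace Summit.Ventures.Crystal3D.Kissing125
open Literature.Geometry.DiscreteGeometry
open Real RealInnerProductSpace InnerProductGeometry Finset

section Dictionary
open Real RealInnerProductSpace Finset Kissing125.KissingSearch
variable {S : Set (EuclideanSpace ℝ (Fin 3))}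

/-- **The `KConf` of a kissing configuration** `V ∈ 𝒱`: labels `0 … 11` for the points of
`V/2`, Gram entries `⟪·, ·⟫`, the labelled fan triangles of the hull of `V/2` and their
angles; all the axioms are theorems about `V`. [cite: Hales2012, Definition 1 and proof of Theorem 3] -/
def IsKissingConfig25.kconf (hS : IsKissingConfig25 S) : KConf :=
  have hX1 : ∀ y ∈ hS.unitConfig, ‖y‖ = 1 := fun _ hy => hS.norm_of_mem_unitConfig hy
  have h12 := hS.card_unitConfig
  have hp := hS.inner_le_half_of_mem_unitConfig
  have h0 := hS.zero_mem_interior_unitConfig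
  { g := fun a b => ⟪hS.pt a, hS.pt b⟫
    T := hS.kT
    ang := hS.kang
    g_symm := fun a b => real_inner_comm _ _
    mem_T := fun tl htl => by
      obtain ⟨t, ht, rfl⟩ := Finset.mem_image.1 htl
      rw [hS.card_image_lab (subset_of_mem_fanTriSets hX1 ht)]
      exact ⟨card_eq_three_of_mem_fanTriSets hX1 ht, fun a _ => by
        obtain ⟨x, -, rfl⟩ := Finset.mem_image.1 ‹a ∈ _›; exact hS.lab_lt x⟩
    card_T := by
      unfold IsKissingConfig25.kT
      rw [Finset.card_image_of_injOn fun t ht t' ht' h => hS.eq_of_image_lab_eq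
        (subset_of_mem_fanTriSets hX1 (Finset.mem_coe.1 ht)) (subset_of_mem_fanTriSets hX1 (Finset.mem_coe.1 ht')) h]
      exact card_fanTriSets h12 hX1 h0
    two := fun tl htl a ha b hb hab => by
      obtain ⟨ht, hlt⟩ := hS.mem_kT.1 htl
      have ha12 := hlt a ha
      have hb12 := hlt b hb
      have hpa : hS.pt a ∈ tl.image hS.pt := Finset.mem_image_of_mem _ ha
      have hpb : hS.pt b ∈ tl.image hS.pt := Finset.mem_image_of_mem _ hb
      have hne : hS.pt a ≠ hS.pt b := fun h => hab (hS.pt_inj ha12 hb12 h)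
      have h2 := card_filter_fanTriSets_eq_two hX1 h0 ht
        (Finset.insert_subset_iff.2 ⟨hpa, Finset.singleton_subset_iff.2 hpb⟩) (Finset.card_pair hne)
      rw [← h2]
      unfold IsKissingConfig25.kT
      rw [Finset.filter_image, Finset.card_image_of_injOn fun t ht t' ht' h => hS.eq_of_image_lab_eq
        (subset_of_mem_fanTriSets hX1 (Finset.mem_filter.1 (Finset.mem_coe.1 ht)).1)
        (subset_of_mem_fanTriSets hX1 (Finset.mem_filter.1 (Finset.mem_coe.1 ht')).1) h]
      congr 1
      refine Finset.filter_congr fun t ht => ?_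
      have htX := subset_of_mem_fanTriSets hX1 ht
      simp only [hS.mem_image_lab htX, Finset.insert_subset_iff, Finset.singleton_subset_iff]
      tauto
    contact_side := fun a b ha hb hab hg => by
      have hne : hS.pt a ≠ hS.pt b := fun h => hab (hS.pt_inj ha hb h)
      obtain ⟨t, ht, hat, hbt⟩ := exists_mem_fanTriSets_of_contact hX1 h0 (by norm_num : (-1 : ℝ) < 1 / 2) hp
        (hS.pt_mem ha) (hS.pt_mem hb) hne hg
      have htX := subset_of_mem_fanTriSets hX1 ht
      exact ⟨t.image hS.lab, hS.image_lab_mem_kT ht, (hS.mem_image_lab htX).2 ⟨ha, hat⟩, (hS.mem_image_lab htX).2 ⟨hb, hbt⟩⟩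
    dichot := fun a b ha hb hab => by
      have hne : hS.pt a ≠ hS.pt b := fun h => hab (hS.pt_inj ha hb h)
      rcases hS.inner_of_mem_unitConfig (hS.pt_mem ha) (hS.pt_mem hb) hne with h | h
      · exact Or.inl h
      · right
        refine ⟨neg_one_le_real_inner_of_norm_eq_one (hS.norm_pt ha) (hS.norm_pt hb), ?_⟩
        unfold κ0R κ0; push_cast; linarith
    side_bound := fun tl htl a ha b hb _ => by
      obtain ⟨ht, -⟩ := hS.mem_kT.1 htl
      have := neg_half_lt_inner_of_mem_fanTriSets h12 hX1 hp ht (Finset.mem_image_of_mem _ ha)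
        (Finset.mem_image_of_mem _ hb)
      linarith
    cdeg_le := fun a ha => by
      refine le_trans ?_ (hS.card_filter_inner_eq_half_le_four (hS.pt_mem ha))
      refine Finset.card_le_card_of_injOn hS.pt (fun b hb => ?_) fun b hb b' hb' h => ?_
      · rw [Finset.mem_coe, Finset.mem_filter] at hb ⊢
        exact ⟨hS.pt_mem (Finset.mem_range.1 hb.1), hb.2.2⟩
      · rw [Finset.mem_coe, Finset.mem_filter, Finset.mem_range] at hb hb'
        exact hS.pt_inj hb.1 hb'.1 h
    contacts_ge := by
      classical
      refine le_trans hS.twentythree_le (Finset.card_le_card_of_surjOn (fun p => ({hS.pt p.1, hS.pt p.2} : Finset (EuclideanSpace ℝ (Fin 3)))) ?_)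
      intro T hT
      rw [Finset.mem_coe] at hT
      unfold contactPairsAt at hT
      rw [Finset.mem_filter, Finset.mem_powerset] at hT
      obtain ⟨hTX, u, v, huv, hin, rfl⟩ := hT
      have hu : u ∈ hS.unitConfig := hTX (by simp)
      have hv : v ∈ hS.unitConfig := hTX (by simp)
      have hlab : hS.lab u ≠ hS.lab v := fun h => huv (hS.lab_injOn hu hv h)
      rcases Nat.lt_or_gt_of_ne hlab with hlt | hlt
      · refine ⟨(hS.lab u, hS.lab v), ?_, ?_⟩
        · rw [Finset.mem_coe, Finset.mem_filter, Finset.mem_product, Finset.mem_range, Finset.mem_range]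
          exact ⟨⟨hS.lab_lt u, hS.lab_lt v⟩, hlt, by simp only [hS.pt_lab hu, hS.pt_lab hv]; exact hin⟩
        · simp only [hS.pt_lab hu, hS.pt_lab hv]
      · refine ⟨(hS.lab v, hS.lab u), ?_, ?_⟩
        · rw [Finset.mem_coe, Finset.mem_filter, Finset.mem_product, Finset.mem_range, Finset.mem_range]
          exact ⟨⟨hS.lab_lt v, hS.lab_lt u⟩, hlt, by simp only [hS.pt_lab hu, hS.pt_lab hv, real_inner_comm u v]; exact hin⟩
        · simp only [hS.pt_lab hu, hS.pt_lab hv, Finset.pair_comm]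
    node := fun v hv => by
      unfold IsKissingConfig25.kT
      rw [Finset.sum_image fun t ht t' ht' h => hS.eq_of_image_lab_eq
        (subset_of_mem_fanTriSets hX1 ht) (subset_of_mem_fanTriSets hX1 ht') h]
      rw [Finset.sum_congr rfl fun t ht => hS.kang_image_lab ht hv]
      exact sum_triAngleAt hX1 h0 (hS.pt_mem hv)
    ang_nonneg := fun tl v => by
      unfold IsKissingConfig25.kang; split_ifs
      · exact triAngleAt_nonneg _ _ _
      · exact le_rfl
    ang_le_pi := fun tl v => by
      unfold IsKissingConfig25.kang; split_ifs
      · exact Literature.Geometry.DiscreteGeometry.triAngleAt_le_pi' hX1 _ _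
      · positivity
    ang_zero := fun tl _ v hv => by
      unfold IsKissingConfig25.kang; rw [if_neg hv]
    cos_law := fun tl htl v hv a ha b hb hva hvb hab => by
      obtain ⟨ht, hlt⟩ := hS.mem_kT.1 htl
      have nva : hS.pt v ≠ hS.pt a := fun h => hva (hS.pt_inj (hlt v hv) (hlt a ha) h)
      have nvb : hS.pt v ≠ hS.pt b := fun h => hvb (hS.pt_inj (hlt v hv) (hlt b hb) h)
      have htri := hS.image_pt_eq_triple htl hv ha hb hva hvb hab
      have hang : hS.kang tl v = triAngleAt hS.unitConfig {hS.pt v, hS.pt a, hS.pt b} (hS.pt v) := by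
        unfold IsKissingConfig25.kang; rw [if_pos hv, htri]
      rw [htri] at ht
      have h := cos_triAngleAt_mul hX1 ht nva nvb
      have n1 : ‖perpTo (hS.pt v) (hS.pt a)‖ = Real.sqrt (1 - ⟪hS.pt v, hS.pt a⟫ ^ 2) := by
        rw [← norm_perpTo_sq_of_norm_eq_one (hS.norm_pt (hlt v hv)) (hS.norm_pt (hlt a ha)),
          Real.sqrt_sq (norm_nonneg _)]
      have n2 : ‖perpTo (hS.pt v) (hS.pt b)‖ = Real.sqrt (1 - ⟪hS.pt v, hS.pt b⟫ ^ 2) := by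
        rw [← norm_perpTo_sq_of_norm_eq_one (hS.norm_pt (hlt v hv)) (hS.norm_pt (hlt b hb)),
          Real.sqrt_sq (norm_nonneg _)]
      rw [hang, ← n1, ← n2, h]
    circum := fun tl htl v hv a ha b hb hva hvb hab => by
      obtain ⟨ht, hlt⟩ := hS.mem_kT.1 htl
      have nva : hS.pt v ≠ hS.pt a := fun h => hva (hS.pt_inj (hlt v hv) (hlt a ha) h)
      have nvb : hS.pt v ≠ hS.pt b := fun h => hvb (hS.pt_inj (hlt v hv) (hlt b hb) h)
      have nab : hS.pt a ≠ hS.pt b := fun h => hab (hS.pt_inj (hlt a ha) (hlt b hb) h)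
      obtain ⟨c, hc, htc⟩ := exists_subset_tightSet_of_mem_fanTriSets hX1 ht
      exact Literature.Geometry.DiscreteGeometry.KissingSearch.Pfun_pos_of_three_tight h12 hX1 hp hc (htc (Finset.mem_image_of_mem _ hv))
        (htc (Finset.mem_image_of_mem _ ha)) (htc (Finset.mem_image_of_mem _ hb)) nva nvb nab
    pairing := fun p q v w hpq hvw htv htw gvp gvq gwp gwq => by
      obtain ⟨htv', hl1⟩ := hS.mem_kT.1 htv
      obtain ⟨htw', hl2⟩ := hS.mem_kT.1 htw
      have hp12 : p < 12 := hl1 p (by simp)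
      have hq12 : q < 12 := hl1 q (by simp)
      have hv12 : v < 12 := hl1 v (by simp)
      have hw12 : w < 12 := hl2 w (by simp)
      have npq : hS.pt p ≠ hS.pt q := fun h => hpq (hS.pt_inj hp12 hq12 h)
      have nvw : hS.pt v ≠ hS.pt w := fun h => hvw (hS.pt_inj hv12 hw12 h)
      simp only [Finset.image_insert, Finset.image_singleton] at htv' htw'
      rw [real_inner_comm] at gvp gvq gwp gwq
      exact inner_nonneg_of_two_apexes hX1 npq nvw htv' htw' (by rwa [real_inner_comm]) (by rwa [real_inner_comm])
        (by rwa [real_inner_comm]) (by rwa [real_inner_comm])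
    link := fun v hv A hA hne hcl => by
      -- transport to the point sets
      set y := hS.pt v with hy
      have key := fanTriSets_link hX1 h0 (y := y) (A := A.image fun tl => tl.image hS.pt) ?_ ?_ ?_
      · -- back to labels
        have hAimg : (A.image fun tl => tl.image hS.pt).image (fun t => t.image hS.lab) = A := by
          rw [Finset.image_image]
          conv_rhs => rw [← Finset.image_id (s := A)]
          refine Finset.image_congr fun tl htl => ?_
          have htlT := (Finset.mem_filter.1 (hA (Finset.mem_coe.1 htl))).1
          exact hS.image_lab_image_pt (hS.mem_kT.1 htlT).2
        rw [← hAimg, key]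
        unfold IsKissingConfig25.kT
        rw [Finset.filter_image]
        congr 1
        refine Finset.filter_congr fun t ht => ?_
        simp only [hS.mem_image_lab (subset_of_mem_fanTriSets hX1 ht), hv, true_and, hy]
      · intro t ht
        obtain ⟨tl, htl, rfl⟩ := Finset.mem_image.1 ht
        obtain ⟨htlT, hvtl⟩ := Finset.mem_filter.1 (hA htl)
        exact Finset.mem_filter.2 ⟨(hS.mem_kT.1 htlT).1, Finset.mem_image_of_mem _ hvtl⟩
      · exact hne.image _
      · intro t ht t' ht' hyt' hcard
        obtain ⟨tl, htl, rfl⟩ := Finset.mem_image.1 ht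
        obtain ⟨htlT, hvtl⟩ := Finset.mem_filter.1 (hA htl)
        have ht'X := subset_of_mem_fanTriSets hX1 ht'
        have htl' : t'.image hS.lab ∈ hS.kT := hS.image_lab_mem_kT ht'
        have hvtl' : v ∈ t'.image hS.lab := (hS.mem_image_lab ht'X).2 ⟨hv, hyt'⟩
        have hinter : (tl ∩ t'.image hS.lab).card = 2 := by
          have htlX : tl.image hS.pt ⊆ hS.unitConfig := subset_of_mem_fanTriSets hX1 (hS.mem_kT.1 htlT).1
          have e1 : tl = (tl.image hS.pt).image hS.lab := (hS.image_lab_image_pt (hS.mem_kT.1 htlT).2).symm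
          rw [e1, ← Finset.image_inter_of_injOn _ _ fun x hx x' hx' h => hS.lab_injOn ?_ ?_ h,
            hS.card_image_lab (Finset.inter_subset_left.trans htlX), hcard]
          · rcases hx with h' | h'
            · exact htlX (Finset.mem_coe.1 h')
            · exact ht'X (Finset.mem_coe.1 h')
          · rcases hx' with h' | h'
            · exact htlX (Finset.mem_coe.1 h')
            · exact ht'X (Finset.mem_coe.1 h')
        have hmem := hcl tl htl (t'.image hS.lab) htl' hvtl' hinter
        rw [← hS.image_pt_image_lab ht'X]
        exact Finset.mem_image_of_mem _ hmem
    conn := fun D hD hne hcl => by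
      have hDpt : D.image hS.pt ⊆ hS.unitConfig := by
        intro x hx
        obtain ⟨a, ha, rfl⟩ := Finset.mem_image.1 hx
        exact hS.pt_mem (Finset.mem_range.1 (hD ha))
      have key := eq_of_fanTriSets_closed hX1 h0 hDpt (hne.image _) fun t ht x hxt hxD => ?_
      · apply Finset.eq_of_subset_of_card_le hD
        rw [Finset.card_range, ← h12, ← key]
        exact Finset.card_image_le
      · obtain ⟨a, haD, rfl⟩ := Finset.mem_image.1 hxD
        have ha12 := Finset.mem_range.1 (hD haD)
        have htX := subset_of_mem_fanTriSets hX1 ht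
        have hsub := hcl (t.image hS.lab) (hS.image_lab_mem_kT ht) ⟨a, (hS.mem_image_lab htX).2 ⟨ha12, hxt⟩, haD⟩
        rw [← hS.image_pt_image_lab htX]
        exact Finset.image_subset_image hsub
    cover := fun v hv => by
      obtain ⟨c, hc⟩ := exists_mem_facetsAt hX1 h0 (hS.pt_mem hv)
      obtain ⟨hcF, hyc⟩ := mem_facetsAt.1 hc
      obtain ⟨i, hi, hyi, -⟩ := exists_fanTriangle_with_apex hX1 hcF hyc
      have ht : fanVerts hS.unitConfig (c, i) ∈ fanTriSets hS.unitConfig := mem_fanTriSets.2 ⟨_, hi, rfl⟩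
      exact ⟨_, hS.image_lab_mem_kT ht, (hS.mem_image_lab (subset_of_mem_fanTriSets hX1 ht)).2 ⟨hv, hyi⟩⟩ }

/-! ### Part D. From the conclusion of the search to the contact graph of `V` -/

/-- The half of a point of `V` is in `V/2`. [folklore] -/
theorem IsKissingConfig25.half_mem_unitConfig (hS : IsKissingConfig25 S) {s : (EuclideanSpace ℝ (Fin 3))} (hs : s ∈ S) :
    (1 / 2 : ℝ) • s ∈ hS.unitConfig :=
  hS.mem_unitConfig.2 ⟨s, hs, rfl⟩

/-- Twice a point of a label is in `V`. [folklore] -/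
theorem IsKissingConfig25.two_smul_pt_mem (hS : IsKissingConfig25 S) {a : ℕ} (ha : a < 12) : (2 : ℝ) • hS.pt a ∈ S := by
  obtain ⟨s, hs, h⟩ := hS.mem_unitConfig.1 (hS.pt_mem ha)
  rw [← h, smul_smul]; norm_num; exact hs

/-- The `Fin 12`-label of a point of `V`. [folklore] -/
def IsKissingConfig25.flab (hS : IsKissingConfig25 S) (s : S) : Fin 12 :=
  ⟨hS.lab ((1 / 2 : ℝ) • (s : (EuclideanSpace ℝ (Fin 3)))), hS.lab_lt _⟩

/-- The point of `V` of a `Fin 12`-label. [folklore] -/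
def IsKissingConfig25.fpt (hS : IsKissingConfig25 S) (k : Fin 12) : S :=
  ⟨(2 : ℝ) • hS.pt k, hS.two_smul_pt_mem k.2⟩

/-- `V ≃ Fin 12` by the labelling. [folklore] -/
def IsKissingConfig25.equivFin (hS : IsKissingConfig25 S) : S ≃ Fin 12 where
  toFun := hS.flab
  invFun := hS.fpt
  left_inv s := by
    apply Subtype.ext
    show (2 : ℝ) • hS.pt (hS.lab ((1 / 2 : ℝ) • (s : (EuclideanSpace ℝ (Fin 3))))) = s
    rw [hS.pt_lab (hS.half_mem_unitConfig s.2), smul_smul]; norm_num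
  right_inv k := by
    apply Fin.ext
    show hS.lab ((1 / 2 : ℝ) • ((2 : ℝ) • hS.pt k)) = k
    rw [smul_smul, show (1 / 2 : ℝ) * 2 = 1 by norm_num, one_smul, hS.lab_pt k.2]

/-- The point of the label of `s ∈ V` is `s/2`. [folklore] -/
theorem IsKissingConfig25.pt_flab (hS : IsKissingConfig25 S) (s : S) : hS.pt (hS.flab s) = (1 / 2 : ℝ) • (s : (EuclideanSpace ℝ (Fin 3))) :=
  hS.pt_lab (hS.half_mem_unitConfig s.2)

/-- Contact in `V` is inner product `1/2` in `V/2`. [folklore] -/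
theorem IsKissingConfig25.dist_eq_two_iff (hS : IsKissingConfig25 S) (s t : S) :
    dist (s : (EuclideanSpace ℝ (Fin 3))) t = 2 ↔ ⟪(1 / 2 : ℝ) • (s : (EuclideanSpace ℝ (Fin 3))), (1 / 2 : ℝ) • (t : (EuclideanSpace ℝ (Fin 3)))⟫ = 1 / 2 := by
  have hd := dist_sq_eq_of_norm_eq_two (hS.norm_eq s.2) (hS.norm_eq t.2)
  rw [real_inner_smul_left, real_inner_smul_right]
  constructor
  · intro h; rw [h] at hd; linarith
  · intro h
    have h4 : dist (s : (EuclideanSpace ℝ (Fin 3))) t ^ 2 = 4 := by rw [hd]; linarith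
    nlinarith [dist_nonneg (x := (s : (EuclideanSpace ℝ (Fin 3)))) (y := t)]

/-- **From the conclusion of the search to the contact graph.**  If the `KConf` of `V` has an
FCC or HCP contact graph (by a bijection of the labels), then the contact graph of `V` is
isomorphic to that of the FCC or of the HCP kissing configuration. [cite: Hales2012, Lemma 9] -/
theorem IsKissingConfig25.contactGraphFccOrHcp_of_concl (hS : IsKissingConfig25 S) (h : hS.kconf.Concl) :
    Nonempty (contactGraph S ≃g contactGraph ((fun p => (2 : ℝ) • p) '' (fccKissingPattern : Set (EuclideanSpace ℝ (Fin 3))))) ∨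
    Nonempty (contactGraph S ≃g contactGraph ((fun p => (2 : ℝ) • p) '' (hcpKissingPattern : Set (EuclideanSpace ℝ (Fin 3))))) := by
  obtain ⟨i, hi, e, he⟩ := h
  -- the isomorphism with `tameContactGraph i`
  have iso : contactGraph S ≃g tameContactGraph i :=
    { toEquiv := hS.equivFin.trans e
      map_rel_iff' := by
        intro s t
        show (tameContactGraph i).Adj (e (hS.flab s)) (e (hS.flab t)) ↔ (contactGraph S).Adj s t
        rw [tameContactGraph_adj, contactGraph_adj, hS.dist_eq_two_iff, ← he, ← he]
        change e (hS.flab s) ≠ e (hS.flab t) ∧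
          (((hS.flab s : ℕ) ≠ hS.flab t ∧ ⟪hS.pt (hS.flab s), hS.pt (hS.flab t)⟫ = 1 / 2) ∨
           ((hS.flab t : ℕ) ≠ hS.flab s ∧ ⟪hS.pt (hS.flab t), hS.pt (hS.flab s)⟫ = 1 / 2)) ↔ _
        rw [hS.pt_flab, hS.pt_flab, real_inner_comm ((1 / 2 : ℝ) • (t : (EuclideanSpace ℝ (Fin 3))))]
        constructor
        · rintro ⟨-, ⟨-, h⟩ | ⟨-, h⟩⟩ <;> exact h
        · intro h
          have hst : (s : (EuclideanSpace ℝ (Fin 3))) ≠ t := by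
            intro hst
            rw [hst, real_inner_smul_left, real_inner_smul_right, real_inner_self_eq_norm_sq, hS.norm_eq t.2] at h
            norm_num at h
          have hlab : hS.flab s ≠ hS.flab t := by
            intro hl
            apply hst
            have h1 := hS.pt_flab s
            have h2 := hS.pt_flab t
            rw [hl] at h1
            exact smul_right_injective (EuclideanSpace ℝ (Fin 3)) (by norm_num : (1 / 2 : ℝ) ≠ 0) (h1.symm.trans h2)
          refine ⟨fun h' => hlab (e.injective h'), Or.inl ⟨fun h' => hlab (Fin.ext h'), h⟩⟩ }
  rcases hi with rfl | rfl
  · exact Or.inr ⟨iso.trans nonempty_tameContactGraph_zero_iso_hcp.some⟩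
  · exact Or.inl ⟨iso.trans nonempty_tameContactGraph_one_iso_fcc.some⟩


/-- **The geometric half at `κ = 7/32`**: if every `KConf` (dichotomy «contact ∨ cos ≤ 7/32»)
has an FCC or HCP contact graph, then so has every `V ∈ 𝒱(5/2)`.
[cite: Hales2012, Theorem 3 and Lemma 9] -/
theorem contactGraphFccOrHcp25_of_forall_concl (h : ∀ M : KConf, M.Concl) {S : Set (EuclideanSpace ℝ (Fin 3))}
    (hS : IsKissingConfig25 S) :
    Nonempty (contactGraph S ≃g contactGraph ((fun p => (2 : ℝ) • p) '' (fccKissingPattern : Set (EuclideanSpace ℝ (Fin 3))))) ∨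
    Nonempty (contactGraph S ≃g contactGraph ((fun p => (2 : ℝ) • p) '' (hcpKissingPattern : Set (EuclideanSpace ℝ (Fin 3))))) :=
  hS.contactGraphFccOrHcp_of_concl (h hS.kconf)

end Dictionary


/-! ## K25 rigidity wrapper (Lemma 10 at σ = 7/8; the tree's `IsRealization` rigidity is generic in σ < 8/9) -/

section Rigidity

open Real RealInnerProductSpace Finset

end Rigidity
end Summit.Ventures.Crystal3D.Kissing125
end
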